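import Literature.AnabelianGeometry.SemiGraphs.TemperedDeltaTower
import Literature.GroupTheory.CombinatorialGroupTheory.FreeGroupoidFiniteRank
import HarnessLib

/-!
# [SemiAnbd] §6 / Ex. 3.10: the André tower of `Π^temp_{X_K}` from a `Π`-normal André tower of `Δ^temp_X`

Mochizuki, *Semi-graphs of anabelioids*, Publ. RIMS **42** (2006) [SemiAnbd], §6 p. 69 (the exact
sequence `1 → Δ^temp_X → Π^temp_{X_K} → G_K → 1` of TEMPERED groups), Example 3.10 pp. 43–45
("`Π := π₁^temp(X^log_K)` … is a tempered topological group … and fits into a natural exact sequence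
`1 → Δ → Π → G_K → 1`, where `Δ := π₁^temp(X^log_K̄)`"; "`Δ` is the inverse limit of the `Δ[i]`"),
Lemma 6.1 p. 69 (print: [André], §4.5 / Lemma 3.2.1). [cite: MochizukiSemiAnbd2006, §6 p.69]

PROOF-ONLY file (abc-iut cell, prover abc-iut-w5-d240, row «Ex310-CURVE-BRIDGE», step S1; no
definitions, no instances, no named facts).  The cell's discharges of [SemiAnbd] Lem. 6.1 (iii) /
6.3 (iii) / Thm. 6.4 / Thm. 6.6 instance forms and of [EtTh] Lem. 2.17 (ii) all consume ONE structural
input `htower₀` for `Π^temp_{X_K}`: cofinal open normal `N ⊴ Π^temp_{X_K}` with `Π^temp_{X_K}/N`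
containing a free, normal, finite-index, finite-rank, NON-ABELIAN subgroup.  `TemperedDeltaTower.lean`
(abc-iut-w5-d139) derives the `Δ^temp_X`-form from the `Π^temp_{X_K}`-form.  This file proves the
CONVERSE passage, which is the one the Ex. 3.10 special-fibre data feeds (the special-fibre tower lives
over `Δ`):

* `exists_free_normal_of_free_finiteIndex` — a group with a free, finite-rank, non-abelian subgroup
  of finite index has a free, NORMAL, finite-rank, non-abelian subgroup of finite index (normal core +
  Schreier's index formula + `exists_not_commute_of_finiteIndex`);
* `TemperedCurve.tower_of_piNormal_deltaTower` — **for `X : TemperedCurve p` with `Π^temp_{X_K}`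
  tempered and first countable: if `Δ^temp_X` admits, inside every neighbourhood of `1` of
  `Π^temp_{X_K}`, an open normal subgroup `M` which is NORMAL IN `Π^temp_{X_K}` and such that
  `Δ^temp_X/M` contains a free, finite-rank, non-abelian subgroup of finite index, then `Π^temp_{X_K}`
  has the André tower property `htower₀`.**  Mechanism: `M = Δ ∩ V` with `V` open; an open normal
  `H' ⊴ Π` inside `V ∩ W` (`W ⊴ Π` a given small open normal subgroup; Def. 3.1 (i) basis);
  `N := M · H'` is open and normal with `Δ ∩ N = M` (Dedekind), and `Δ/M ≅ ΔN/N ↪ Π/N` has finite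
  index because the augmentation is an OPEN map onto the compact `G_K` (open-mapping theorem for
  tempered groups, `isOpenMap_augGK_of_isTempered`); then `exists_free_normal_of_free_finiteIndex`;
* `TemperedCurve.tower_of_piNormal_deltaTower'` — the same under the parameter bundle
  `d : X.GroupLevelData` (ruling η′: "`Π^temp` tempered, Galois-countable").

The `Π`-normality of the `M` is essential (an André tower of `Δ^temp_X` by subgroups merely normal in
`Δ^temp_X` does not suffice: their `Π`-cores have subdirect-product quotients).  Classical topological
group theory; nothing here bears on [IUTchIII] Cor. 3.12 or takes a side on any disputed claim.
-/

noncomputable section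

namespace Literature.AnabelianGeometry.SemiGraphs

open _root_.Topology
open scoped Pointwise
open Literature.AnabelianGeometry.EtaleTheta.DiscreteNormalizers
open Literature.GroupTheory.CombinatorialGroupTheory

universe u

/-! ### S2. Normal cores of free finite-index subgroups -/

/-- **A free, finite-rank, non-abelian subgroup of finite index contains a NORMAL one**: its normal
core has finite index (finitely many conjugates), is free (Nielsen–Schreier) of finite rank
(Schreier's index formula, `SchreierIndex.exists_freeGroupBasis_of_finiteIndex`) and is non-abelian
(`exists_not_commute_of_finiteIndex`). [cite: LyndonSchupp2001, Ch. I Prop. 3.9] -/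
theorem exists_free_normal_of_free_finiteIndex {A : Type u} [Group A] (K : Subgroup A)
    (hK : IsFreeGroup K) [K.FiniteIndex] (hfin : Finite (IsFreeGroup.Generators K))
    (hab : ∃ a ∈ K, ∃ b ∈ K, a * b ≠ b * a) :
    ∃ (G : Subgroup A) (_ : IsFreeGroup G), G.Normal ∧ G.FiniteIndex ∧
      Finite (IsFreeGroup.Generators G) ∧ ∃ a ∈ G, ∃ b ∈ G, a * b ≠ b * a := by
  haveI := hK
  haveI := hfin
  -- the normal core `G`, and `G` seen inside the free group `K`
  let G : Subgroup A := K.normalCore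
  have hGK : G ≤ K := Subgroup.normalCore_le K
  let C : Subgroup K := G.subgroupOf K
  haveI hCfi : C.FiniteIndex := by
    refine ⟨fun h0 => ?_⟩
    have h := Subgroup.relIndex_mul_index hGK
    change C.index * K.index = G.index at h
    rw [h0, zero_mul] at h
    exact Subgroup.FiniteIndex.index_ne_zero h.symm
  -- Schreier: `C` has a finite free basis; transport it to `G`
  obtain ⟨ι, bC, hιfin, -⟩ := SchreierIndex.exists_freeGroupBasis_of_finiteIndex C
  haveI : Finite ι := hιfin
  let e : C ≃* G := Subgroup.subgroupOfEquivOfLe hGK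
  obtain ⟨hGfree, hGfin⟩ := IsFreeGroup.finite_generators_of_basis (bC.map e)
  refine ⟨G, hGfree, Subgroup.normalCore_normal K, inferInstance, hGfin, ?_⟩
  -- non-abelian: a finite-index subgroup of a non-abelian free group is non-abelian
  obtain ⟨a, ha, b, hb, hab⟩ := hab
  have hab' : (⟨a, ha⟩ : K) * ⟨b, hb⟩ ≠ ⟨b, hb⟩ * ⟨a, ha⟩ := fun h =>
    hab (by simpa using congrArg Subtype.val h)
  obtain ⟨x, hx, y, hy, hxy⟩ := exists_not_commute_of_finiteIndex hab' C
  refine ⟨(x : A), Subgroup.mem_subgroupOf.mp hx, (y : A), Subgroup.mem_subgroupOf.mp hy, fun h => hxy ?_⟩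
  exact Subtype.ext (by simpa using h)

/-! ### S1. The André tower of `Π^temp_{X_K}` from a `Π`-normal André tower of `Δ^temp_X` -/

namespace TemperedCurve

variable {p : ℕ} [Fact p.Prime] (X : TemperedCurve p)

/-- `Ker(augGK) = Δ^temp_X`. [cite: MochizukiSemiAnbd2006, §6 p.69] -/
private theorem ker_augGK_eq : X.augGK.toMonoidHom.ker = X.DeltaTemp := by
  ext g
  rw [MonoidHom.mem_ker]
  change X.augGK g = 1 ↔ X.aug g = 1
  rw [Subtype.ext_iff, coe_augGK_apply]
  rfl

/-- `Δ^temp_X ⊔ L` has finite index in `Π^temp_{X_K}` for every OPEN subgroup `L` (the augmentation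
is an open map onto the compact `G_K`). [cite: MochizukiSemiAnbd2006, §6 p.69] -/
private theorem finiteIndex_deltaTemp_sup (hT : IsTempered X.PiTemp)
    [FirstCountableTopology X.PiTemp] (L : Subgroup X.PiTemp) (hL : IsOpen (L : Set X.PiTemp)) :
    (X.DeltaTemp ⊔ L).FiniteIndex := by
  haveI := X.compactSpace_GK
  have hopen : IsOpen ((L.map X.augGK.toMonoidHom : Subgroup X.GK) : Set X.GK) := by
    rw [Subgroup.coe_map]
    exact X.isOpenMap_augGK_of_isTempered hT _ hL
  haveI : Finite (X.GK ⧸ (L.map X.augGK.toMonoidHom)) := Subgroup.quotient_finite_of_isOpen _ hopen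
  haveI : (L.map X.augGK.toMonoidHom).FiniteIndex := Subgroup.finiteIndex_of_finite_quotient
  have h : X.DeltaTemp ⊔ L = (L.map X.augGK.toMonoidHom).comap X.augGK.toMonoidHom := by
    rw [Subgroup.comap_map_eq, ker_augGK_eq, sup_comm]
  rw [h]
  refine ⟨?_⟩
  rw [Subgroup.index_comap_of_surjective _ X.augGK_surjective]
  exact Subgroup.FiniteIndex.index_ne_zero

/-- **The André tower of `Π^temp_{X_K}` from a `Π`-normal André tower of `Δ^temp_X`** ([SemiAnbd]
§6 p. 69 / Ex. 3.10; [André 2003] §4.5).  Let `X : TemperedCurve p` with `Π^temp_{X_K}` tempered and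
first countable.  Suppose that inside every neighbourhood of `1` of `Π^temp_{X_K}` there is an open
normal subgroup `M` of `Δ^temp_X` whose image in `Π^temp_{X_K}` is NORMAL and such that `Δ^temp_X/M`
contains a free, finite-rank, non-abelian subgroup of finite index.  Then `Π^temp_{X_K}` has the
tower property `htower₀`: cofinal open normal `N` with `Π^temp_{X_K}/N` containing a free, normal,
finite-index, finite-rank, non-abelian subgroup (`N := M · H'` for a small open normal `H' ⊴ Π`
meeting `Δ^temp_X` inside `M`; `Δ/M ≅ ΔN/N` has finite index in `Π/N` by the open augmentation onto
the compact `G_K`; normal core by `exists_free_normal_of_free_finiteIndex`).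
[cite: MochizukiSemiAnbd2006, §6 p.69] -/
theorem tower_of_piNormal_deltaTower (hT : IsTempered X.PiTemp) [FirstCountableTopology X.PiTemp]
    (hΔ : ∀ U ∈ 𝓝 (1 : X.PiTemp), ∃ M : OpenNormalSubgroup X.DeltaTemp,
      (M.toSubgroup.map X.DeltaTemp.subtype).Normal ∧ (∀ x ∈ M, (x : X.PiTemp) ∈ U) ∧
      ∃ (G : Subgroup (X.DeltaTemp ⧸ M.toSubgroup)) (_ : IsFreeGroup G), G.FiniteIndex ∧
        Finite (IsFreeGroup.Generators G) ∧ ∃ a ∈ G, ∃ b ∈ G, a * b ≠ b * a) :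
    ∀ U ∈ 𝓝 (1 : X.PiTemp), ∃ N : OpenNormalSubgroup X.PiTemp, (N : Set X.PiTemp) ⊆ U ∧
      ∃ (G : Subgroup (X.PiTemp ⧸ N.toSubgroup)) (_ : IsFreeGroup G), G.Normal ∧ G.FiniteIndex ∧
        Finite (IsFreeGroup.Generators G) ∧ ∃ a ∈ G, ∃ b ∈ G, a * b ≠ b * a := by
  classical
  intro U hU
  -- a small open normal `W ⊴ Π` inside `U`, and the `Δ`-datum inside `W`
  obtain ⟨W, -, hWU⟩ := hT.basis U hU
  haveI : W.toSubgroup.Normal := W.isNormal'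
  obtain ⟨M, hMn, hMW, G, hG, hGfi, hGfin, a, ha, b, hb, hab⟩ :=
    hΔ W W.toOpenSubgroup.mem_nhds_one
  haveI := hG
  haveI := hGfi
  haveI : M.toSubgroup.Normal := M.isNormal'
  -- `M = Δ ∩ V` with `V` open in `Π`
  obtain ⟨V, hVo, hVM⟩ := isOpen_induced_iff.mp M.toOpenSubgroup.isOpen
  have h1V : (1 : X.PiTemp) ∈ V := by
    have h1 : (1 : X.DeltaTemp) ∈ (Subtype.val ⁻¹' V : Set X.DeltaTemp) := by
      rw [hVM]; exact M.toOpenSubgroup.one_mem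
    exact h1
  -- a small open normal `H' ⊴ Π` inside `V ∩ W`
  obtain ⟨H', -, hH'⟩ := hT.basis (V ∩ W)
    (Filter.inter_mem (hVo.mem_nhds h1V) W.toOpenSubgroup.mem_nhds_one)
  haveI : H'.toSubgroup.Normal := H'.isNormal'
  -- the image `Mim` of `M` in `Π` and `N := Mim · H'`
  set Mim : Subgroup X.PiTemp := M.toSubgroup.map X.DeltaTemp.subtype with hMim
  haveI : Mim.Normal := hMn
  let N : Subgroup X.PiTemp := Mim ⊔ H'.toSubgroup
  have hNopen : IsOpen (N : Set X.PiTemp) :=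
    Subgroup.isOpen_mono (le_sup_right : H'.toSubgroup ≤ N) H'.toOpenSubgroup.isOpen
  haveI hNn : N.Normal := inferInstance
  let NO : OpenNormalSubgroup X.PiTemp :=
    { toSubgroup := N, isOpen' := hNopen, isNormal' := hNn }
  refine ⟨NO, ?_, ?_⟩
  · -- `N ⊆ W ⊆ U`
    intro x hx
    obtain ⟨m, hm, h, hh, rfl⟩ := Subgroup.mem_sup_of_normal_right.mp hx
    apply hWU
    obtain ⟨m', hm', rfl⟩ := hm
    exact W.toSubgroup.mul_mem (hMW m' hm') (hH' hh).2
  · -- the trace `Δ ∩ N = M`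
    have hΔN : ∀ x : X.DeltaTemp, (x : X.PiTemp) ∈ (NO.toSubgroup : Subgroup X.PiTemp) ↔ x ∈ M := by
      intro x
      constructor
      · intro hx
        obtain ⟨m, hm, h, hh, hx⟩ := Subgroup.mem_sup_of_normal_right.mp hx
        obtain ⟨m', hm', rfl⟩ := hm
        -- `h = m'⁻¹ x ∈ Δ ∩ H' ⊆ Δ ∩ V = M`
        have hhΔ : h ∈ X.DeltaTemp := by
          have : h = ((m' : X.PiTemp))⁻¹ * x := by
            rw [← hx, Subgroup.coe_subtype, inv_mul_cancel_left]
          rw [this]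
          exact X.DeltaTemp.mul_mem (X.DeltaTemp.inv_mem m'.2) x.2
        have hhM : (⟨h, hhΔ⟩ : X.DeltaTemp) ∈ M := by
          have : (⟨h, hhΔ⟩ : X.DeltaTemp) ∈ (Subtype.val ⁻¹' V : Set X.DeltaTemp) := (hH' hh).1
          rw [hVM] at this
          exact this
        have hxeq : x = m' * ⟨h, hhΔ⟩ := Subtype.ext (by simpa using hx.symm)
        rw [hxeq]
        exact M.toSubgroup.mul_mem hm' hhM
      · intro hx
        exact le_sup_left (b := H'.toSubgroup) ⟨x, hx, rfl⟩
    -- the injection `θ : Δ/M ↪ Π/N` and its range `Δ̄ = ΔN/N`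
    let π : X.PiTemp →* X.PiTemp ⧸ NO.toSubgroup := QuotientGroup.mk' NO.toSubgroup
    let θ : X.DeltaTemp ⧸ M.toSubgroup →* X.PiTemp ⧸ NO.toSubgroup :=
      QuotientGroup.map M.toSubgroup NO.toSubgroup X.DeltaTemp.subtype fun x h => (hΔN x).2 h
    have hθmk : ∀ δ : X.DeltaTemp, θ (QuotientGroup.mk δ) = π (δ : X.PiTemp) := fun _ => rfl
    have hθinj : Function.Injective θ := by
      rw [injective_iff_map_eq_one]
      intro q hq
      obtain ⟨δ, rfl⟩ := QuotientGroup.mk_surjective q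
      rw [hθmk] at hq
      have hδ : (δ : X.PiTemp) ∈ NO.toSubgroup := (QuotientGroup.eq_one_iff (δ : X.PiTemp)).1 hq
      exact (QuotientGroup.eq_one_iff δ).2 ((hΔN δ).1 hδ)
    have hθrange : θ.range = X.DeltaTemp.map π := by
      ext q
      constructor
      · rintro ⟨r, rfl⟩
        obtain ⟨δ, rfl⟩ := QuotientGroup.mk_surjective r
        exact ⟨δ, δ.2, (hθmk δ).symm⟩
      · rintro ⟨g, hg, rfl⟩
        exact ⟨QuotientGroup.mk ⟨g, hg⟩, hθmk ⟨g, hg⟩⟩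
    -- `Δ̄` has finite index in `Π/N` (open augmentation onto compact `G_K`)
    haveI hΔbar_fi : (X.DeltaTemp.map π).FiniteIndex := by
      refine ⟨?_⟩
      rw [← Subgroup.index_comap_of_surjective _ (QuotientGroup.mk'_surjective NO.toSubgroup),
        Subgroup.comap_map_eq, QuotientGroup.ker_mk']
      exact (X.finiteIndex_deltaTemp_sup hT NO.toSubgroup hNopen).index_ne_zero
    -- the image `K := θ(G)`: free of finite rank, non-abelian, of finite index in `Π/N`
    let K : Subgroup (X.PiTemp ⧸ NO.toSubgroup) := G.map θ
    let eK : G ≃* K := Subgroup.equivMapOfInjective G θ hθinj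
    obtain ⟨hKfree, hKfin⟩ := IsFreeGroup.exists_isFreeGroup_finite_generators_of_mulEquiv eK
      ⟨hG, hGfin⟩
    haveI hKfi : K.FiniteIndex := by
      refine ⟨?_⟩
      change (G.map θ).index ≠ 0
      rw [G.index_map_of_injective hθinj, hθrange]
      exact mul_ne_zero hGfi.index_ne_zero hΔbar_fi.index_ne_zero
    have habK : ∃ x ∈ K, ∃ y ∈ K, x * y ≠ y * x := by
      refine ⟨θ a, ⟨a, ha, rfl⟩, θ b, ⟨b, hb, rfl⟩, fun h => hab (hθinj ?_)⟩
      rw [map_mul, map_mul]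
      exact h
    exact exists_free_normal_of_free_finiteIndex K hKfree hKfin habK

/-- **The André tower of `Π^temp_{X_K}` from a `Π`-normal André tower of `Δ^temp_X`**, under the
parameter bundle `d : X.GroupLevelData` of ruling η′ ("`Π^temp` tempered, Galois-countable").
[cite: MochizukiSemiAnbd2006, §6 p.69] -/
theorem tower_of_piNormal_deltaTower' (d : X.GroupLevelData)
    (hΔ : ∀ U ∈ 𝓝 (1 : X.PiTemp), ∃ M : OpenNormalSubgroup X.DeltaTemp,
      (M.toSubgroup.map X.DeltaTemp.subtype).Normal ∧ (∀ x ∈ M, (x : X.PiTemp) ∈ U) ∧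
      ∃ (G : Subgroup (X.DeltaTemp ⧸ M.toSubgroup)) (_ : IsFreeGroup G), G.FiniteIndex ∧
        Finite (IsFreeGroup.Generators G) ∧ ∃ a ∈ G, ∃ b ∈ G, a * b ≠ b * a) :
    ∀ U ∈ 𝓝 (1 : X.PiTemp), ∃ N : OpenNormalSubgroup X.PiTemp, (N : Set X.PiTemp) ⊆ U ∧
      ∃ (G : Subgroup (X.PiTemp ⧸ N.toSubgroup)) (_ : IsFreeGroup G), G.Normal ∧ G.FiniteIndex ∧
        Finite (IsFreeGroup.Generators G) ∧ ∃ a ∈ G, ∃ b ∈ G, a * b ≠ b * a := by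
  haveI := d.secondCountableTopology
  exact X.tower_of_piNormal_deltaTower d.isTempered hΔ

/-- Conversely to `TemperedDeltaTower.lean`: under the hypotheses of `tower_of_piNormal_deltaTower`
BOTH `Π^temp_{X_K}` and `Δ^temp_X` have the André tower property.
[cite: MochizukiSemiAnbd2006, §6 p.69] -/
theorem tower_and_deltaTemp_tower_of_piNormal_deltaTower (hT : IsTempered X.PiTemp)
    [FirstCountableTopology X.PiTemp]
    (hΔ : ∀ U ∈ 𝓝 (1 : X.PiTemp), ∃ M : OpenNormalSubgroup X.DeltaTemp,
      (M.toSubgroup.map X.DeltaTemp.subtype).Normal ∧ (∀ x ∈ M, (x : X.PiTemp) ∈ U) ∧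
      ∃ (G : Subgroup (X.DeltaTemp ⧸ M.toSubgroup)) (_ : IsFreeGroup G), G.FiniteIndex ∧
        Finite (IsFreeGroup.Generators G) ∧ ∃ a ∈ G, ∃ b ∈ G, a * b ≠ b * a) :
    (∀ U ∈ 𝓝 (1 : X.PiTemp), ∃ N : OpenNormalSubgroup X.PiTemp, (N : Set X.PiTemp) ⊆ U ∧
      ∃ (G : Subgroup (X.PiTemp ⧸ N.toSubgroup)) (_ : IsFreeGroup G), G.Normal ∧ G.FiniteIndex ∧
        Finite (IsFreeGroup.Generators G) ∧ ∃ a ∈ G, ∃ b ∈ G, a * b ≠ b * a) ∧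
    (∀ U ∈ 𝓝 (1 : X.DeltaTemp), ∃ N : OpenNormalSubgroup X.DeltaTemp, (N : Set X.DeltaTemp) ⊆ U ∧
      ∃ (G : Subgroup (X.DeltaTemp ⧸ N.toSubgroup)) (_ : IsFreeGroup G), G.Normal ∧ G.FiniteIndex ∧
        Finite (IsFreeGroup.Generators G) ∧ ∃ a ∈ G, ∃ b ∈ G, a * b ≠ b * a) :=
  ⟨X.tower_of_piNormal_deltaTower hT hΔ,
    X.deltaTemp_tower_of_tower_of_isTempered hT (X.tower_of_piNormal_deltaTower hT hΔ)⟩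

end TemperedCurve

end Literature.AnabelianGeometry.SemiGraphs

end
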